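import Mathlib.NumberTheory.DiophantineApproximation.Basic
import Mathlib.Analysis.SpecialFunctions.Log.Basic
import HarnessLib

/-!
# Integer linear forms in one irrational number cannot be too small — a transference lemma

Topic `Literature/NumberTheory/DiophantineApproximation`. Everything in this file is PROVED.

**Lemma** (`no_integer_forms_of_irrational`). Let `ξ` be irrational and let `P_n + Q_n ξ`
(`P_n, Q_n ∈ ℤ`) be a sequence of integer linear forms with, for all large `n`,
`e^{-A₁ n} ≤ |P_n + Q_n ξ| ≤ e^{-A₂ n}` and `|Q_n| ≤ e^{B n}`, where `0 < A₂ ≤ A₁`, `0 ≤ B`.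
Then `A₁ + B ≥ 2 A₂`. Equivalently: if `A₁ + B < 2 A₂`, no such forms exist.

This is the case of ONE irrational number (`m = 1`) of Nesterenko's linear independence
criterion (Yu. V. Nesterenko, *On the linear independence of numbers*, Vestnik Moskov. Univ.
Ser. I Mat. Mekh. (1985) no. 1, 46–49 = Moscow Univ. Math. Bull. 40 (1985) 69–74, Theorem 1), in a
"two-rate" form: only exponential upper and lower bounds for the forms are assumed, not an exact
asymptotic rate `|P_n + Q_n ξ|^{1/n} → α`. With an exact rate `A₁ = A₂ = -log α`, `B = log β` the
conclusion `A₁ + B ≥ 2A₂` is Nesterenko's `1 - log α / log β ≤ 2 = dim_ℚ(ℚ + ℚξ)`, i.e. it carries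
no information; the point of the two-rate form is that it is exactly what is needed to convert
Hermite–Padé forms in `1, Li₁(1/N), Li₂(1/N)` into a contradiction once a hypothetical linear
relation has been used to eliminate `Li₂(1/N)` (the general criterion for one number is then
applied to forms whose exact rate is unknown).

Proof (the transference argument of S. Fischler and W. Zudilin, *A refinement of Nesterenko's
linear independence criterion with applications to zeta values*, Math. Ann. 347 (2010) 739–763,
specialised to one number, where Minkowski's theorem becomes Dirichlet's approximation theorem):
by Dirichlet's theorem (Mathlib `Real.exists_int_int_abs_mul_sub_le`) and the irrationality of
`ξ` there are `j/q` with `q` arbitrarily large and `|qξ - j| ≤ 1/q`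
(`exists_le_abs_mul_sub_int_le`). With `n = ⌈log(2q)/A₂⌉` the integer
`q P_n + Q_n j = q (P_n + Q_n ξ) - Q_n (qξ - j)` has absolute value
`≤ q e^{-A₂ n} + e^{Bn}/q ≤ 1/2 + e^B (2q)^{B/A₂}/q < 1` for `q` large (as `B < A₂`), so it
vanishes; then `q e^{-A₁ n} ≤ q |P_n + Q_n ξ| = |Q_n| |qξ - j| ≤ e^{Bn}/q` gives
`q² ≤ e^{(A₁+B) n} ≤ e^{A₁+B} (2q)^{(A₁+B)/A₂}`, impossible for `q` large when `(A₁+B)/A₂ < 2`.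
All estimates are carried out on the logarithmic scale `L = log q`.

## References

* Yu. V. Nesterenko, *On the linear independence of numbers*, Vestnik Moskov. Univ. Ser. I Mat.
  Mekh. (1985) no. 1, 46–49; Moscow Univ. Math. Bull. 40 (1985) 69–74, Theorem 1. [Nesterenko1985]
* S. Fischler, W. Zudilin, *A refinement of Nesterenko's linear independence criterion with
  applications to zeta values*, Math. Ann. 347 (2010) 739–763, §2 (the transference principle).
* P. G. L. Dirichlet's approximation theorem — Mathlib `Real.exists_int_int_abs_mul_sub_le`.
-/

open Filter

namespace Literature.NumberTheory.DiophantineApproximation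

/-- For an irrational `ξ` and a bound `K`, the finitely many numbers `q ξ` with `0 < q < K` keep a
uniform positive distance `δ` from the integers: `δ ≤ |q ξ - j|` for all `j ∈ ℤ`. [folklore] -/
theorem exists_pos_forall_le_abs_mul_sub_int {ξ : ℝ} (hξ : Irrational ξ) (K : ℕ) :
    ∃ δ : ℝ, 0 < δ ∧ ∀ q : ℕ, 0 < q → q < K → ∀ j : ℤ, δ ≤ |(q : ℝ) * ξ - j| := by
  induction K with
  | zero => exact ⟨1, one_pos, fun q _ hq => absurd hq (Nat.not_lt_zero q)⟩
  | succ K ih =>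
    obtain ⟨δ, hδ, h⟩ := ih
    rcases Nat.eq_zero_or_pos K with hK | hK
    · exact ⟨δ, hδ, fun q hq hqK => absurd hqK (by omega)⟩
    · refine ⟨min δ |(K : ℝ) * ξ - round ((K : ℝ) * ξ)|, lt_min hδ ?_, fun q hq hqK j => ?_⟩
      · exact abs_pos.2 (sub_ne_zero.2 ((hξ.natCast_mul hK.ne').ne_int _))
      · rcases (Nat.lt_succ_iff.1 hqK).lt_or_eq with hlt | rfl
        · exact (min_le_left _ _).trans (h q hq hlt j)
        · exact (min_le_right _ _).trans (round_le _ _)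

/-- **Dirichlet's approximation theorem with large denominators.** For an irrational `ξ` and
every `K` there are a natural number `q ≥ K`, `q > 0`, and an integer `j` with `|q ξ - j| ≤ 1/q`.
(Dirichlet's theorem at a level `M` with `1/(M+1)` below the distance of `ξ, 2ξ, …, (K-1)ξ` from
`ℤ` produces a denominator `q ≤ M` which cannot be `< K`.) [folklore] -/
theorem exists_le_abs_mul_sub_int_le {ξ : ℝ} (hξ : Irrational ξ) (K : ℕ) :
    ∃ q : ℕ, ∃ j : ℤ, K ≤ q ∧ 0 < q ∧ |(q : ℝ) * ξ - j| ≤ 1 / q := by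
  obtain ⟨δ, hδ, h⟩ := exists_pos_forall_le_abs_mul_sub_int hξ K
  obtain ⟨M₁, hM₁⟩ := exists_nat_gt (1 / δ)
  have hpos : 0 < M₁ + K + 1 := Nat.succ_pos _
  obtain ⟨j, k, hk0, hkM, hjk⟩ := Real.exists_int_int_abs_mul_sub_le ξ hpos
  obtain ⟨q, rfl⟩ := Int.eq_ofNat_of_zero_le hk0.le
  have hq0 : 0 < q := by exact_mod_cast hk0
  have hqM : (q : ℝ) ≤ (M₁ : ℝ) + K + 1 := by exact_mod_cast hkM
  have hjk' : |(q : ℝ) * ξ - j| ≤ 1 / ((M₁ : ℝ) + K + 1 + 1) := by exact_mod_cast hjk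
  have hq0' : (0 : ℝ) < q := by exact_mod_cast hq0
  refine ⟨q, j, ?_, hq0, hjk'.trans (one_div_le_one_div_of_le hq0' (by linarith))⟩
  by_contra! hlt
  have h1 : 1 < (M₁ : ℝ) * δ := by rwa [div_lt_iff₀ hδ] at hM₁
  have h2 := h q hq0 hlt j
  have hK0 : (0 : ℝ) ≤ δ * K := mul_nonneg hδ.le K.cast_nonneg
  have h3 : 1 / ((M₁ : ℝ) + K + 1 + 1) < δ := by
    rw [div_lt_iff₀ (by positivity)]
    nlinarith
  linarith

/-- **Integer linear forms in one irrational number cannot be too small** (the case of one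
irrational number of Nesterenko's 1985 linear independence criterion, in two-rate form). Let `ξ`
be irrational, `0 < A₂ ≤ A₁`, `0 ≤ B` and `A₁ + B < 2A₂`. Then there is NO sequence of integer
linear forms `P_n + Q_n ξ` with `e^{-A₁ n} ≤ |P_n + Q_n ξ| ≤ e^{-A₂ n}` and `|Q_n| ≤ e^{B n}` for
all large `n`. Proof by transference over Dirichlet's approximation theorem (Fischler–Zudilin),
see the module docstring.
[cite: Nesterenko1985, Theorem 1 (case of one irrational, two-rate form)] -/
theorem no_integer_forms_of_irrational {ξ : ℝ} (hξ : Irrational ξ) {A₁ A₂ B : ℝ}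
    (hA₂ : 0 < A₂) (hA : A₂ ≤ A₁) (hB : 0 ≤ B) (hgap : A₁ + B < 2 * A₂) (P Q : ℕ → ℤ)
    (hlow : ∀ᶠ n : ℕ in Filter.atTop, Real.exp (-(A₁ * n)) ≤ |(P n : ℝ) + Q n * ξ|)
    (hup : ∀ᶠ n : ℕ in Filter.atTop, |(P n : ℝ) + Q n * ξ| ≤ Real.exp (-(A₂ * n)))
    (hQ : ∀ᶠ n : ℕ in Filter.atTop, |(Q n : ℝ)| ≤ Real.exp (B * n)) : False := by
  -- Step 1: a common threshold `n₀` for the three bounds.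
  obtain ⟨n₀, hn₀⟩ := eventually_atTop.1 (hlow.and (hup.and hQ))
  -- The two exponents `κ = B/A₂ < 1` and `θ = (A₁ + B)/A₂ < 2`.
  set κ : ℝ := B / A₂ with hκ
  set θ : ℝ := (A₁ + B) / A₂ with hθ
  have hκ1 : κ < 1 := by rw [hκ, div_lt_one hA₂]; linarith
  have hθ2 : θ < 2 := by rw [hθ, div_lt_iff₀ hA₂]; linarith
  have hκA : κ * A₂ = B := by rw [hκ]; exact div_mul_cancel₀ B hA₂.ne'
  have hθA : θ * A₂ = A₁ + B := by rw [hθ]; exact div_mul_cancel₀ (A₁ + B) hA₂.ne'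
  set l2 : ℝ := Real.log 2 with hl2
  have hl2pos : 0 < l2 := Real.log_pos one_lt_two
  have hhalf : Real.exp (-l2) = 1 / 2 := by
    rw [Real.exp_neg, hl2, Real.exp_log two_pos, one_div]
  -- Step 2: the three largeness conditions on `L = log q`, and a `K` beyond all of them.
  have hev : ∀ᶠ L : ℝ in atTop, A₂ * n₀ ≤ L ∧ B + l2 * κ + l2 < L * (1 - κ) ∧
      A₁ + B + l2 * θ < L * (2 - θ) :=
    (eventually_ge_atTop _).and
      (((tendsto_id.atTop_mul_const (by linarith : (0 : ℝ) < 1 - κ)).eventually_gt_atTop _).and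
        ((tendsto_id.atTop_mul_const (by linarith : (0 : ℝ) < 2 - θ)).eventually_gt_atTop _))
  have hlog : Tendsto (fun q : ℕ => Real.log q) atTop atTop :=
    Real.tendsto_log_atTop.comp tendsto_natCast_atTop_atTop
  obtain ⟨K, hK⟩ := eventually_atTop.1 (hlog.eventually hev)
  -- Step 3: a good approximation `j/q` with `q ≥ K`, and the index `n = ⌈log (2q) / A₂⌉`.
  obtain ⟨q, j, hKq, hq0, hqj⟩ := exists_le_abs_mul_sub_int_le hξ K
  obtain ⟨h1, h2, h3⟩ : A₂ * n₀ ≤ Real.log q ∧ B + l2 * κ + l2 < Real.log q * (1 - κ) ∧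
      A₁ + B + l2 * θ < Real.log q * (2 - θ) := hK q hKq
  set L : ℝ := Real.log q with hL
  have hq0' : (0 : ℝ) < q := by exact_mod_cast hq0
  have hexpL : Real.exp L = q := by rw [hL, Real.exp_log hq0']
  set t : ℝ := (l2 + L) / A₂ with ht
  have hA₂t : A₂ * t = l2 + L := by rw [ht]; exact mul_div_cancel₀ (l2 + L) hA₂.ne'
  have hL0 : 0 ≤ L := (mul_nonneg hA₂.le n₀.cast_nonneg).trans h1
  have ht0 : 0 ≤ t := by rw [ht]; exact div_nonneg (by linarith) hA₂.le
  set n : ℕ := ⌈t⌉₊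
  have htn : t ≤ n := Nat.le_ceil t
  have hnt : (n : ℝ) < t + 1 := Nat.ceil_lt_add_one ht0
  -- `n ≥ n₀`, so the three bounds hold at `n`.
  have hn₀n : n₀ ≤ n := by
    have h : (n₀ : ℝ) ≤ t := by
      rw [ht, le_div_iff₀ hA₂]
      linarith
    exact_mod_cast h.trans htn
  obtain ⟨hlow', hup', hQ'⟩ := hn₀ n hn₀n
  -- Exponent bookkeeping: `A₂ n ≥ log (2q)`, `B n ≤ κ log (2q) + B` and
  -- `(A₁ + B) n ≤ θ log (2q) + A₁ + B`.
  have hA₂n : l2 + L ≤ A₂ * n := by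
    have := mul_le_mul_of_nonneg_left htn hA₂.le
    linarith
  have hBt : B * t = κ * (l2 + L) := by rw [← hA₂t, ← mul_assoc, hκA]
  have hθt : (A₁ + B) * t = θ * (l2 + L) := by rw [← hA₂t, ← mul_assoc, hθA]
  have hBn : B * n ≤ κ * (l2 + L) + B := by
    have := mul_le_mul_of_nonneg_left hnt.le hB
    linarith
  have hABn : (A₁ + B) * n ≤ θ * (l2 + L) + (A₁ + B) := by
    have := mul_le_mul_of_nonneg_left hnt.le (by linarith : (0 : ℝ) ≤ A₁ + B)
    linarith
  -- Step 4: the small form `ℓ`, the approximation error `ε`, and the integer `q P_n + Q_n j`.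
  set ℓ : ℝ := (P n : ℝ) + Q n * ξ with hℓ
  set ε : ℝ := (q : ℝ) * ξ - j with hε
  have hI : ((q * P n + Q n * j : ℤ) : ℝ) = q * ℓ - Q n * ε := by
    rw [hℓ, hε]; push_cast; ring
  -- (a) `q |ℓ| ≤ q e^{-A₂ n} ≤ 1/2`.
  have hb1 : (q : ℝ) * |ℓ| ≤ 1 / 2 := by
    calc (q : ℝ) * |ℓ| ≤ q * Real.exp (-(A₂ * n)) := mul_le_mul_of_nonneg_left hup' hq0'.le
      _ = Real.exp (L - A₂ * n) := by rw [Real.exp_sub, Real.exp_neg, hexpL, div_eq_mul_inv]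
      _ ≤ Real.exp (-l2) := Real.exp_le_exp.2 (by linarith)
      _ = 1 / 2 := hhalf
  -- (b) `|Q_n| |ε| ≤ e^{B n} / q < 1/2`.
  have hb2 : |(Q n : ℝ)| * |ε| ≤ Real.exp (B * n - L) := by
    calc |(Q n : ℝ)| * |ε| ≤ Real.exp (B * n) * (1 / q) :=
          mul_le_mul hQ' hqj (abs_nonneg _) (Real.exp_pos _).le
      _ = Real.exp (B * n - L) := by rw [Real.exp_sub, hexpL, mul_one_div]
  have hBnL : B * n - L < -l2 := by linarith
  have hb2' : |(Q n : ℝ)| * |ε| < 1 / 2 :=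
    hb2.trans_lt (by rw [← hhalf]; exact Real.exp_lt_exp.2 hBnL)
  -- (c) Hence the integer `q P_n + Q_n j` has absolute value `< 1`, so it vanishes.
  have hI0 : q * P n + Q n * j = 0 := by
    have h : |((q * P n + Q n * j : ℤ) : ℝ)| < 1 := by
      rw [hI]
      calc |(q : ℝ) * ℓ - Q n * ε| ≤ |(q : ℝ) * ℓ| + |(Q n : ℝ) * ε| := abs_sub _ _
        _ = q * |ℓ| + |(Q n : ℝ)| * |ε| := by rw [abs_mul, abs_mul, Nat.abs_cast]
        _ < 1 := by linarith
    have h' : ((|q * P n + Q n * j| : ℤ) : ℝ) < (1 : ℤ) := by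
      rw [Int.cast_abs, Int.cast_one]; exact h
    exact Int.abs_lt_one_iff.1 (Int.cast_lt.1 h')
  -- Step 5: `q ℓ = Q_n ε`, so the lower bound `e^{-A₁ n} ≤ |ℓ|` transfers to `q² ≤ e^{(A₁+B) n}`.
  have hqℓ : (q : ℝ) * ℓ = Q n * ε := sub_eq_zero.1 (by rw [← hI, hI0, Int.cast_zero])
  have hb3 : Real.exp (L - A₁ * n) ≤ Real.exp (B * n - L) := by
    calc Real.exp (L - A₁ * n) = q * Real.exp (-(A₁ * n)) := by
          rw [Real.exp_sub, Real.exp_neg, hexpL, div_eq_mul_inv]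
      _ ≤ q * |ℓ| := mul_le_mul_of_nonneg_left hlow' hq0'.le
      _ = |(Q n : ℝ)| * |ε| := by rw [← abs_mul, ← hqℓ, abs_mul, Nat.abs_cast]
      _ ≤ Real.exp (B * n - L) := hb2
  have hfin : L - A₁ * n ≤ B * n - L := Real.exp_le_exp.1 hb3
  -- `2 L ≤ (A₁ + B) n ≤ θ (log 2 + L) + A₁ + B < 2 L`: contradiction.
  linarith
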